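import Mathlib
import HarnessLib
import Literature.RingTheory.CohomologyAnnihilator.SyzygyBaseChange
import Summits.ResolutionOfSingularities.ResolutionOfSingularities.Theorems.HomologicalConductorNoZenoStableAnnihilatorReduction

set_option linter.dupNamespace false

/-!
# Syzygies of retracts of base changes; stable annihilation under base change and retracts

`[OURS · L w44b · completion model, ascent half · res-type-015 gen 15]` — fifth brick towards the
discharge of the named fact `Literature.RingTheory.CohomologyAnnihilator.le_caCompletion_comap`
([BahlekehHakimianSalarianTakahashi2015, Thm. 4.5 (2)]), helper for the surface rung
`PersistenceSurface` (stmt-ResolutionOfSingularities-19970) of crux chain w44b.  NOT a statement of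
the manuscript under adjudication in cell res-hironaka; folklore homological bookkeeping over the
tree's `IsSyzygy` / `StablyAnnihilates` (`Literature.RingTheory.CohomologyAnnihilator.*`,
`…NoZenoStableAnnihilatorReduction`).

* `StablyAnnihilates.mul_left`, `.of_retract`, `.prod_projective`, `.baseChange` — closure
  properties of «`c • 𝟙 M` factors through a finitely generated projective»;
* `exists_projective_isSyzygy_self` — a finitely generated projective has finitely generated
  projective `t`-th syzygies (itself, or `0`);
* `exists_retract_isSyzygy_of_retract_of_isSyzygy` — `t`-th syzygies of a retract: if `X` is a
  retract of `Z`, `K_X = Ωᵗ X`, `K_Z = Ωᵗ Z`, then `K_X` is a retract of `K_Z ⊕ Q`, `Q` finitely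
  generated projective (the tree's `exists_retract_isSyzygy_of_retract` is `t = 1`);
* `exists_retract_baseChange_syzygy` — if `X` is an `S`-retract of `S ⊗_R N` (`S` flat over
  noetherian `R`, `N` finitely generated) then `Ωᵗ_S X` is a retract of `(S ⊗_R Ωᵗ_R N) ⊕ Q`;
  `exists_retract_baseChange_syzygy_local` — for `S` local, of `S ⊗_R (Ωᵗ_R N ⊕ Rⁿ)`.

References: S. B. Iyengar, R. Takahashi, arXiv:1404.1476, §2 («syzygies are defined up to projective
summands») [`IyengarTakahashi2014`].
-/

noncomputable section

open CategoryTheory CategoryTheory.Limits Literature.RingTheory.CohomologyAnnihilator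
open Summit.ResolutionOfSingularities.ResolutionOfSingularities.Theorems.NoZeno.SandwichCluster
open scoped TensorProduct

universe u

namespace Summit.ResolutionOfSingularities.ResolutionOfSingularities.Theorems.HomologicalConductor.CompletionAscentSyzygyRetract

variable {T : Type u} [CommRing T]

/-! ## Closure properties of stable annihilation -/

/-- If `c • 𝟙 M` factors through a finitely generated projective, so does `(c' c) • 𝟙 M`.
[folklore] -/
theorem StablyAnnihilates.mul_left {c : T} (c' : T) {M : ModuleCat.{u} T}
    (h : StablyAnnihilates T c M) : StablyAnnihilates T (c' * c) M := by
  obtain ⟨P, hPfin, hPproj, ι, π, hιπ⟩ := h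
  exact ⟨P, hPfin, hPproj, c' • ι, π, by rw [Linear.smul_comp, hιπ, smul_smul]⟩

/-- Stable annihilation passes to retracts. [folklore] -/
theorem StablyAnnihilates.of_retract {c : T} {X Z : ModuleCat.{u} T} (i : X ⟶ Z) (p : Z ⟶ X)
    (hip : i ≫ p = 𝟙 X) (h : StablyAnnihilates T c Z) : StablyAnnihilates T c X := by
  obtain ⟨P, hPfin, hPproj, ι, π, hιπ⟩ := h
  refine ⟨P, hPfin, hPproj, i ≫ ι, π ≫ p, ?_⟩
  rw [Category.assoc, ← Category.assoc ι, hιπ, Linear.smul_comp, Linear.comp_smul,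
    Category.id_comp, hip]

/-- Stable annihilation is stable under adding a finitely generated projective summand.
[folklore] -/
theorem StablyAnnihilates.prod_projective {c : T} {K Q : ModuleCat.{u} T}
    (h : StablyAnnihilates T c K) (hQ : Module.Finite T Q) (hQproj : Projective Q) :
    StablyAnnihilates T c (ModuleCat.of T (K × Q)) := by
  obtain ⟨P, hPfin, hPproj, ι, π, hιπ⟩ := h
  haveI := hPfin
  haveI := hQ
  refine ⟨ModuleCat.of T (P × Q), inferInstance, projective_prod hPproj hQproj,
    ModuleCat.ofHom (ι.hom.prodMap LinearMap.id), ModuleCat.ofHom (π.hom.prodMap (c • LinearMap.id)),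
    ?_⟩
  apply ModuleCat.hom_ext
  refine LinearMap.ext fun x => ?_
  obtain ⟨k, q⟩ := x
  change (π.hom (ι.hom k), (c • LinearMap.id (R := T) (M := Q)) q) = c • (k, q)
  rw [apply_apply_eq_smul_of_comp_eq_smul_id hιπ k]
  rfl

/-- **Stable annihilation ascends along base change**: if `a • 𝟙 M` factors through a finitely
generated projective `R`-module, then `a • 𝟙 (S ⊗_R M)` factors through a finitely generated
projective `S`-module. [folklore] -/
theorem StablyAnnihilates.baseChange {R : Type u} [CommRing R] (S : Type u) [CommRing S]
    [Algebra R S] {a : R} {M : ModuleCat.{u} R} (h : StablyAnnihilates R a M) :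
    StablyAnnihilates S (algebraMap R S a) (ModuleCat.of S (S ⊗[R] M)) := by
  obtain ⟨P, hPfin, hPproj, ι, π, hιπ⟩ := h
  haveI := hPfin
  haveI := moduleProjective_of_projective P hPproj
  refine ⟨ModuleCat.of S (S ⊗[R] P), Module.Finite.base_change R S P,
    (IsProjective.iff_projective (R := S) (S ⊗[R] P)).mp inferInstance,
    ModuleCat.ofHom (ι.hom.baseChange S), ModuleCat.ofHom (π.hom.baseChange S), ?_⟩
  apply ModuleCat.hom_ext
  refine LinearMap.ext fun x => ?_
  change π.hom.baseChange S (ι.hom.baseChange S x) = algebraMap R S a • x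
  induction x using TensorProduct.induction_on with
  | zero => rw [map_zero, map_zero, smul_zero]
  | tmul s m =>
    rw [LinearMap.baseChange_tmul, LinearMap.baseChange_tmul,
      apply_apply_eq_smul_of_comp_eq_smul_id hιπ m, TensorProduct.tmul_smul, algebraMap_smul]
  | add x y hx hy => rw [map_add, map_add, hx, hy, smul_add]

/-! ## Syzygies of projectives and of retracts -/

/-- A zero module is an `s`-th syzygy of a zero module, for every `s`. [folklore] -/
theorem isSyzygy_punit_punit : ∀ s : ℕ,
    IsSyzygy s (ModuleCat.of T PUnit.{u + 1}) (ModuleCat.of T PUnit.{u + 1})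
  | 0 => ⟨Iso.refl _⟩
  | s + 1 => by
      have h : IsSyzygy (1 + s) (ModuleCat.of T PUnit.{u + 1}) (ModuleCat.of T PUnit.{u + 1}) :=
        (isSyzygy_punit_punit s).trans
          (isSyzygy_one_of_isZero (ModuleCat.isZero_of_subsingleton _)
            (ModuleCat.isZero_of_subsingleton _))
      exact Nat.add_comm 1 s ▸ h

/-- A finitely generated projective module has, for every `t`, a finitely generated projective
`t`-th syzygy (itself for `t = 0`, zero for `t ≥ 1`). [folklore] -/
theorem exists_projective_isSyzygy_self {Q : ModuleCat.{u} T} (hQ : Module.Finite T Q)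
    (hQproj : Projective Q) :
    ∀ t : ℕ, ∃ Q' : ModuleCat.{u} T, Module.Finite T Q' ∧ Projective Q' ∧ IsSyzygy t Q Q'
  | 0 => ⟨Q, hQ, hQproj, ⟨Iso.refl Q⟩⟩
  | t + 1 => ⟨ModuleCat.of T PUnit.{u + 1}, inferInstance, projective_punit, by
      have h := (isSyzygy_one_projective hQ hQproj).trans (isSyzygy_punit_punit (T := T) t)
      exact Nat.add_comm 1 t ▸ h⟩

/-- **`t`-th syzygies of a retract**: if `X` is a retract of `Z` (`i ≫ p = 𝟙 X`), `K_Z` is a `t`-th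
syzygy of `Z` and `K_X` one of `X`, then `K_X` is a retract of `K_Z ⊕ Q` for some finitely generated
projective `Q` (induction on `t` from the tree's first-syzygy case). [folklore] -/
theorem exists_retract_isSyzygy_of_retract_of_isSyzygy :
    ∀ (t : ℕ) {X Z KX KZ : ModuleCat.{u} T} (i : X ⟶ Z) (p : Z ⟶ X), i ≫ p = 𝟙 X →
      IsSyzygy t Z KZ → IsSyzygy t X KX →
      ∃ Q : ModuleCat.{u} T, Module.Finite T Q ∧ Projective Q ∧
        ∃ (i' : KX ⟶ ModuleCat.of T (KZ × Q)) (p' : ModuleCat.of T (KZ × Q) ⟶ KX),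
          i' ≫ p' = 𝟙 KX
  | 0, X, Z, KX, KZ, i, p, hip, ⟨eZ⟩, ⟨eX⟩ => by
    refine ⟨ModuleCat.of T PUnit.{u + 1}, inferInstance, projective_punit,
      eX.hom ≫ i ≫ eZ.inv ≫ ModuleCat.ofHom (LinearMap.inl T KZ PUnit.{u + 1}),
      ModuleCat.ofHom (LinearMap.fst T KZ PUnit.{u + 1}) ≫ eZ.hom ≫ p ≫ eX.inv, ?_⟩
    have h1 : ModuleCat.ofHom (LinearMap.inl T KZ PUnit.{u + 1}) ≫
        ModuleCat.ofHom (LinearMap.fst T KZ PUnit.{u + 1}) = 𝟙 KZ := by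
      apply ModuleCat.hom_ext
      exact LinearMap.fst_comp_inl T KZ PUnit.{u + 1}
    simp only [Category.assoc]
    rw [← Category.assoc (ModuleCat.ofHom (LinearMap.inl T KZ PUnit.{u + 1})), h1,
      Category.id_comp, eZ.inv_hom_id_assoc, ← Category.assoc i, hip, Category.id_comp,
      eX.hom_inv_id]
  | t + 1, X, Z, KX, KZ, i, p, hip, hZ, hX => by
    obtain ⟨Z₁, hZ₁, hZ'⟩ := isSyzygy_succ_iff_exists_first.mp hZ
    obtain ⟨X₁, hX₁, hX'⟩ := isSyzygy_succ_iff_exists_first.mp hX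
    -- first step: `X₁` is a retract of `Z₁ ⊕ Q₁`
    obtain ⟨Q₁, hQ₁, hQ₁proj, i₁, p₁, hip₁⟩ := exists_retract_isSyzygy_of_retract i p hip hZ₁ hX₁
    -- a `t`-th syzygy of `Z₁ ⊕ Q₁` is `K_Z ⊕ Q₁'`
    obtain ⟨Q₁', hQ₁', hQ₁'proj, hQsyz⟩ := exists_projective_isSyzygy_self hQ₁ hQ₁proj t
    have hZQ : IsSyzygy t (ModuleCat.of T (Z₁ × Q₁)) (ModuleCat.of T (KZ × Q₁')) := hZ'.prod hQsyz
    obtain ⟨Q₂, hQ₂, hQ₂proj, i₂, p₂, hip₂⟩ :=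
      exists_retract_isSyzygy_of_retract_of_isSyzygy t i₁ p₁ hip₁ hZQ hX'
    -- reassociate `(K_Z ⊕ Q₁') ⊕ Q₂ ≅ K_Z ⊕ (Q₁' ⊕ Q₂)`
    haveI := hQ₁'
    haveI := hQ₂
    let e : ((KZ × Q₁') × Q₂) ≃ₗ[T] (KZ × (Q₁' × Q₂)) := LinearEquiv.prodAssoc T KZ Q₁' Q₂
    refine ⟨ModuleCat.of T (Q₁' × Q₂), inferInstance, projective_prod hQ₁'proj hQ₂proj,
      i₂ ≫ ModuleCat.ofHom (X := ModuleCat.of T ((KZ × Q₁') × Q₂))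
        (Y := ModuleCat.of T (KZ × (Q₁' × Q₂))) e.toLinearMap,
      ModuleCat.ofHom (X := ModuleCat.of T (KZ × (Q₁' × Q₂)))
        (Y := ModuleCat.of T ((KZ × Q₁') × Q₂)) e.symm.toLinearMap ≫ p₂, ?_⟩
    rw [Category.assoc, ← Category.assoc (ModuleCat.ofHom e.toLinearMap)]
    have he : ModuleCat.ofHom (X := ModuleCat.of T ((KZ × Q₁') × Q₂))
        (Y := ModuleCat.of T (KZ × (Q₁' × Q₂))) e.toLinearMap ≫
        ModuleCat.ofHom (X := ModuleCat.of T (KZ × (Q₁' × Q₂)))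
        (Y := ModuleCat.of T ((KZ × Q₁') × Q₂)) e.symm.toLinearMap =
          𝟙 (ModuleCat.of T ((KZ × Q₁') × Q₂)) := by
      apply ModuleCat.hom_ext
      exact LinearMap.ext fun x => e.symm_apply_apply x
    rw [he, Category.id_comp, hip₂]

/-! ## Syzygies of a retract of a base change -/

/-- **Syzygies of a retract of a base change.**  Let `S` be flat over the noetherian ring `R`, `N` a
finitely generated `R`-module and `X` an `S`-retract of `S ⊗_R N`.  Then every `t`-th syzygy `K_X`
of `X` over `S` is a retract of `(S ⊗_R K_N) ⊕ Q` with `K_N` a (finitely generated) `t`-th syzygy of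
`N` over `R` and `Q` finitely generated projective over `S` (base change of syzygies,
`IsSyzygy.baseChange`, and `exists_retract_isSyzygy_of_retract_of_isSyzygy`). [folklore] -/
theorem exists_retract_baseChange_syzygy {R S : Type u} [CommRing R] [CommRing S] [Algebra R S]
    [IsNoetherianRing R] [Module.Flat R S] {X : ModuleCat.{u} S} {N : Type u} [AddCommGroup N]
    [Module R N] [Module.Finite R N]
    (i : X ⟶ ModuleCat.of S (S ⊗[R] N)) (p : ModuleCat.of S (S ⊗[R] N) ⟶ X) (hip : i ≫ p = 𝟙 X)
    (t : ℕ) {KX : ModuleCat.{u} S} (hKX : IsSyzygy t X KX) :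
    ∃ (KN : ModuleCat.{u} R) (_ : Module.Finite R KN) (_ : IsSyzygy t (ModuleCat.of R N) KN)
      (Q : ModuleCat.{u} S) (_ : Module.Finite S Q) (_ : Projective Q)
      (i' : KX ⟶ ModuleCat.of S ((S ⊗[R] KN) × Q)) (p' : ModuleCat.of S ((S ⊗[R] KN) × Q) ⟶ KX),
      i' ≫ p' = 𝟙 KX := by
  obtain ⟨KN, hKNfin, hKN⟩ := exists_isSyzygy (ModuleCat.of R N) t
  have hZ : IsSyzygy t (ModuleCat.of S (S ⊗[R] N)) (ModuleCat.of S (S ⊗[R] KN)) :=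
    IsSyzygy.baseChange S t hKN
  obtain ⟨Q, hQ, hQproj, i', p', hip'⟩ :=
    exists_retract_isSyzygy_of_retract_of_isSyzygy t i p hip hZ hKX
  exact ⟨KN, hKNfin, hKN, Q, hQ, hQproj, i', p', hip'⟩

/-- Over a LOCAL ring `S`, a finitely generated projective `Q` is free, hence a base change:
`Q ≅ S ⊗_R (ι → R)` for a finite type `ι`. [folklore] -/
theorem exists_linearEquiv_baseChange_pi_of_projective {R S : Type u} [CommRing R] [CommRing S]
    [Algebra R S] [IsLocalRing S] {Q : ModuleCat.{u} S} (hQ : Module.Finite S Q)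
    (hQproj : Projective Q) :
    ∃ (ι : Type u) (_ : Fintype ι), Nonempty (Q ≃ₗ[S] S ⊗[R] (ι → R)) := by
  classical
  haveI := hQ
  haveI := moduleProjective_of_projective Q hQproj
  haveI : Module.Free S Q := Module.free_of_flat_of_isLocalRing
  let b := Module.Free.chooseBasis S Q
  refine ⟨Module.Free.ChooseBasisIndex S Q, inferInstance,
    ⟨b.equivFun ≪≫ₗ (TensorProduct.piScalarRight R S S (Module.Free.ChooseBasisIndex S Q)).symm⟩⟩

/-- **Syzygies of a retract of a base change, local case.**  With `S` moreover local, every `t`-th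
syzygy `K_X` of an `S`-retract `X` of `S ⊗_R N` is a retract of `S ⊗_R N'` with
`N' = K_N ⊕ (ι → R)` finitely generated, `K_N` a `t`-th syzygy of `N`. [folklore] -/
theorem exists_retract_baseChange_syzygy_local {R S : Type u} [CommRing R] [CommRing S]
    [Algebra R S] [IsNoetherianRing R] [Module.Flat R S] [IsLocalRing S] {X : ModuleCat.{u} S}
    {N : Type u} [AddCommGroup N] [Module R N] [Module.Finite R N]
    (i : X ⟶ ModuleCat.of S (S ⊗[R] N)) (p : ModuleCat.of S (S ⊗[R] N) ⟶ X) (hip : i ≫ p = 𝟙 X)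
    (t : ℕ) {KX : ModuleCat.{u} S} (hKX : IsSyzygy t X KX) :
    ∃ (N' : Type u) (_ : AddCommGroup N') (_ : Module R N') (_ : Module.Finite R N')
      (i' : KX →ₗ[S] S ⊗[R] N') (p' : S ⊗[R] N' →ₗ[S] KX), p' ∘ₗ i' = LinearMap.id := by
  classical
  obtain ⟨KN, hKNfin, -, Q, hQ, hQproj, i₁, p₁, hip₁⟩ := exists_retract_baseChange_syzygy i p hip t hKX
  obtain ⟨ι, hι, ⟨eQ⟩⟩ := exists_linearEquiv_baseChange_pi_of_projective (R := R) hQ hQproj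
  haveI := hKNfin
  -- `(S ⊗ K_N) × Q ≅ (S ⊗ K_N) × (S ⊗ (ι → R)) ≅ S ⊗ (K_N × (ι → R))`
  let e : ((S ⊗[R] KN) × Q) ≃ₗ[S] S ⊗[R] (KN × (ι → R)) :=
    (LinearEquiv.refl S (S ⊗[R] KN)).prodCongr eQ ≪≫ₗ (TensorProduct.prodRight R S S KN (ι → R)).symm
  have hpi : ∀ x, p₁.hom (i₁.hom x) = x := fun x => by
    have := congrArg (fun φ => φ.hom x) hip₁
    simpa using this
  refine ⟨KN × (ι → R), inferInstance, inferInstance, inferInstance,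
    e.toLinearMap ∘ₗ i₁.hom, p₁.hom ∘ₗ e.symm.toLinearMap, LinearMap.ext fun x => ?_⟩
  change p₁.hom (e.symm (e (i₁.hom x))) = x
  rw [e.symm_apply_apply, hpi]

end Summit.ResolutionOfSingularities.ResolutionOfSingularities.Theorems.HomologicalConductor.CompletionAscentSyzygyRetract

end
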